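import Summits.QuantumFields.YangMills.Theorems.F4SubCurvatureDoorShortRootRigidityPlanarConeSupportHolds
import Summits.QuantumFields.YangMills.Theorems.F4SubCurvatureDoorShortRootRigiditySliceInClass
import Summits.QuantumFields.YangMills.Theorems.F4SubCurvatureDoorRationalToGeneralLaplacianMultiplier
import Mathlib
import HarnessLib

/-!
# Diagonal cone support of the Laplace–Fourier measure: `supp μ̂ ⊆ {E ≥ |⟪q⃗, m⟫|}`, `m = (1,1,1)/√3`

Sub-problem `YangMills`, crux ⟨stmt-QuantumFields-23125⟩ `RationalToGeneral.GlobalShortRootRigidity`, rung S1 «FORWARD-CONE SUPPORT»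
(`Cruxes/RationalToGeneral/Lines/forward_cone_rungs.lean`): the first 4-D consequence of the planar cone theorem (C)
✓`planarConeSupport_holds` (aperture `1` for every planar-class kernel) — «the S1 rung from (C) on Gaussian slices»
(planner ym-idea-3 g21).

For `K` in the C3 class with Laplace–Fourier measure `μ` (`IsLF K μ`), the Gaussian transverse slice
`k(t,s) = ∫_{ℝ²} K(ι(t,s) + ι^⊥ x) e^{−‖x‖²/2} dx` along the diagonal plane `Π₀ = span(e₀, m)` is a planar-class kernel
(✓`stub_sliceInClass`), and Fubini + the Gaussian Fourier transform
`∫_{ℝ²} cos(c + ⟪w,x⟫) e^{−‖x‖²/2} dx = 2π e^{−‖w‖²/2} cos c` (`integral_cos_add_inner_mul_gauss`) exhibit a planar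
Laplace–Fourier measure of it EXPLICITLY: the push-forward of `2π e^{−‖q⃗_⊥‖²/2} dμ(E, q⃗)` under `(E, q⃗) ↦ (E, ⟪q⃗, m⟫)`
(`slice_zero_mk2`, `exists_isPlanarLF_slice`).  Since the density is everywhere positive, aperture `1` of that planar measure
(✓`planarConeSupport_holds`) says exactly `μ {E < |⟪q⃗, m⟫|} = 0` (`measure_lt_abs_diag_eq_zero`): the Laplace–Fourier measure
of every class kernel is carried by `{E ≥ |q₁+q₂+q₃|/√3}`.  (The `W(B₃)`-images — the polyhedral cone `{E ≥ ‖q⃗‖₁/√3}` and the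
round aperture `1/√3` — are the companion file `…DiagonalConeSupportPolyhedral`.)  No `def` is introduced (proof lane): the
objects `⟪q⃗,m⟫`, `q⃗_⊥`, the density and the push-forward are written out.

HONEST LABEL: a rung toward S1 (`ForwardConeSupport` = aperture `1` in 4-D), not S1; nothing here touches ⟨23035⟩'s open stub
`OddModeRigidity`; the YM mass gap is NOT proved.
-/

noncomputable section

open MeasureTheory Filter Topology Set Complex
open scoped BigOperators ENNReal NNReal RealInnerProductSpace

namespace Summit.QuantumFields.YangMills.Theorems.F4SubCurvatureDoorDiagonalConeSupport

open Summit.QuantumFields.YangMills.Theorems.F4SubCurvatureDoorLaplaceFourierRegistered (E4 E3 InClass timeSpace IsLF)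
open Summit.QuantumFields.YangMills.Theorems.F4SubCurvatureDoorLaplacianMultiplierRegistered
  (timeSpace_apply_zero timeSpace_apply_succ)
open Summit.QuantumFields.YangMills.Theorems.F4SubCurvatureDoorSmearedSlices (sigmaFinite_of_integrable_exp)
open Summit.QuantumFields.YangMills.Theorems.F4SubCurvatureDoorSliceFourier (integrable_exp_neg_half_sq_norm)
open Summit.QuantumFields.YangMills.Theorems.F4SubCurvatureDoorSliceDensityRegistered
  (E2 planeEmb perpEmb weight slice planeEmb_add_perpEmb_apply_zero planeEmb_add_perpEmb_apply_one
   planeEmb_add_perpEmb_apply_two planeEmb_add_perpEmb_apply_three)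
open Summit.QuantumFields.YangMills.Theorems.F4SubCurvatureDoorSliceInClassRegistered (InPlanarClass stub_sliceInClass)
open Summit.QuantumFields.YangMills.Theorems.F4SubCurvatureDoorPlanarFrameTimeHolomorphyRegistered (mk2)
open Summit.QuantumFields.YangMills.Theorems.F4SubCurvatureDoorPlanarInitialApertureRegistered (IsPlanarLF HasAperture)
open Summit.QuantumFields.YangMills.Theorems.F4SubCurvatureDoorPlanarConeSupportByName (planarConeSupport_holds)

/-! ## 1. The Gaussian Fourier transform on `ℝ²` -/

/-- `∫_{ℝ²} cos(c + ⟪w,x⟫) e^{−‖x‖²/2} dx = 2π e^{−‖w‖²/2} cos c` (real part of the Gaussian Fourier transform). [folklore] -/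
theorem integral_cos_add_inner_mul_gauss (c : ℝ) (w : E2) :
    ∫ x : E2, Real.cos (c + ⟪w, x⟫) * Real.exp (-(‖x‖ ^ 2 / 2)) =
      2 * Real.pi * Real.exp (-(‖w‖ ^ 2 / 2)) * Real.cos c := by
  have hb : 0 < (1 / 2 : ℂ).re := by norm_num
  have hint := GaussianFourier.integrable_cexp_neg_mul_sq_norm_add_of_euclideanSpace hb I w
  have hval := GaussianFourier.integral_cexp_neg_mul_sq_norm_add_of_euclideanSpace hb I w
  have hcard : ((Fintype.card (Fin 2) : ℂ) / 2) = 1 := by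
    rw [Fintype.card_fin]; push_cast; norm_num
  rw [hcard, cpow_one, I_sq] at hval
  have hrhs : (↑Real.pi / (1 / 2) : ℂ) * cexp (-1 * (‖w‖ : ℂ) ^ 2 / (4 * (1 / 2))) =
      ((2 * Real.pi * Real.exp (-(‖w‖ ^ 2 / 2)) : ℝ) : ℂ) := by
    have : (-1 * (‖w‖ : ℂ) ^ 2 / (4 * (1 / 2))) = ((-(‖w‖ ^ 2 / 2) : ℝ) : ℂ) := by push_cast; ring
    rw [this, ← Complex.ofReal_exp]; push_cast; ring
  rw [hrhs] at hval
  have hre : ∀ x : E2, Real.cos (c + ⟪w, x⟫) * Real.exp (-(‖x‖ ^ 2 / 2)) =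
      RCLike.re (cexp (I * c) * cexp (-(1 / 2) * (‖x‖ : ℂ) ^ 2 + I * (⟪w, x⟫ : ℝ))) := by
    intro x
    rw [← Complex.exp_add]
    have : I * c + (-(1 / 2) * (‖x‖ : ℂ) ^ 2 + I * (⟪w, x⟫ : ℝ)) =
        ((-(‖x‖ ^ 2 / 2) : ℝ) : ℂ) + ((c + ⟪w, x⟫ : ℝ) : ℂ) * I := by push_cast; ring
    rw [this, RCLike.re_to_complex, Complex.exp_re]
    simp only [Complex.add_re, Complex.ofReal_re, Complex.mul_re, Complex.I_re, Complex.I_im,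
      Complex.ofReal_im, mul_zero, mul_one, sub_zero, add_zero, Complex.add_im, Complex.mul_im, zero_add]
    ring
  simp_rw [hre]
  rw [integral_re (hint.const_mul _), integral_const_mul, hval, RCLike.re_to_complex]
  rw [show I * (c : ℂ) = ((0 : ℝ) : ℂ) + (c : ℂ) * I by push_cast; ring, Complex.re_mul_ofReal,
    Complex.exp_re]
  simp [mul_comm]

/-- The same in coordinates: `∫_{ℝ²} cos(c + a x₀ + b x₁) e^{−‖x‖²/2} dx = 2π e^{−(a²+b²)/2} cos c`. [folklore] -/
theorem integral_cos_add_lin_mul_gauss (c a b : ℝ) :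
    ∫ x : E2, Real.cos (c + (a * x 0 + b * x 1)) * Real.exp (-(‖x‖ ^ 2 / 2)) =
      2 * Real.pi * Real.exp (-((a ^ 2 + b ^ 2) / 2)) * Real.cos c := by
  have hin : ∀ x : E2, a * x 0 + b * x 1 = ⟪mk2 a b, x⟫ := fun x => by
    simp only [PiLp.inner_apply, RCLike.inner_apply, conj_trivial, Fin.sum_univ_two, mk2]
    simp
    ring
  have hn : ‖mk2 a b‖ ^ 2 = a ^ 2 + b ^ 2 := by
    rw [EuclideanSpace.real_norm_sq_eq, Fin.sum_univ_two]
    simp [mk2]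
  simp_rw [hin]
  rw [integral_cos_add_inner_mul_gauss, hn]

/-! ## 2. Geometry of the diagonal slice -/

/-- `ι (t,s) + ι^⊥ x = (t, s m + x₀ b₁ + x₁ b₂)` with `m = (1,1,1)/√3`, `b₁ = (1,−1,0)/√2`, `b₂ = (1,1,−2)/√6`. -/
theorem planeEmb_mk2_add_perpEmb (t s : ℝ) (x : E2) :
    planeEmb (mk2 t s) + perpEmb x = timeSpace t ((WithLp.equiv 2 (Fin 3 → ℝ)).symm
      ![s / Real.sqrt 3 + (x 0 / Real.sqrt 2 + x 1 / Real.sqrt 6),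
        s / Real.sqrt 3 + (-(x 0 / Real.sqrt 2) + x 1 / Real.sqrt 6), s / Real.sqrt 3 + -(2 * x 1 / Real.sqrt 6)]) := by
  ext i
  cases i using Fin.cases with
  | zero => rw [planeEmb_add_perpEmb_apply_zero, timeSpace_apply_zero]; simp [mk2]
  | succ j =>
    rw [timeSpace_apply_succ]
    fin_cases j
    · show (planeEmb (mk2 t s) + perpEmb x) 1 = _
      rw [planeEmb_add_perpEmb_apply_one]; simp [mk2]
    · show (planeEmb (mk2 t s) + perpEmb x) 2 = _
      rw [planeEmb_add_perpEmb_apply_two]; simp [mk2]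
    · show (planeEmb (mk2 t s) + perpEmb x) 3 = _
      rw [planeEmb_add_perpEmb_apply_three]; simp [mk2]

/-- `⟪q⃗, s m + x₀ b₁ + x₁ b₂⟫ = s ⟪q⃗,m⟫ + ⟪q⃗,b₁⟫ x₀ + ⟪q⃗,b₂⟫ x₁` in coordinates. -/
theorem inner_diag_frame (q : E3) (s : ℝ) (x : E2) :
    ⟪q, (WithLp.equiv 2 (Fin 3 → ℝ)).symm
      ![s / Real.sqrt 3 + (x 0 / Real.sqrt 2 + x 1 / Real.sqrt 6),
        s / Real.sqrt 3 + (-(x 0 / Real.sqrt 2) + x 1 / Real.sqrt 6), s / Real.sqrt 3 + -(2 * x 1 / Real.sqrt 6)]⟫ =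
      s * ((q 0 + q 1 + q 2) / Real.sqrt 3) +
        ((q 0 - q 1) / Real.sqrt 2 * x 0 + (q 0 + q 1 - 2 * q 2) / Real.sqrt 6 * x 1) := by
  simp only [PiLp.inner_apply, RCLike.inner_apply, conj_trivial, Fin.sum_univ_three]
  simp
  field_simp
  ring

/-! ## 3. The diagonal Gaussian slice as a Laplace–Fourier integral (Fubini) -/

/-- `w_0(x) = e^{−‖x‖²/2}`. -/
theorem weight_zero (x : E2) : weight 0 x = Real.exp (-(‖x‖ ^ 2 / 2)) := by simp [weight]

/-- ★ The diagonal Gaussian slice is a Laplace–Fourier integral against `μ` with the transverse Gaussian factor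
`2π e^{−‖q⃗_⊥‖²/2}`, `‖q⃗_⊥‖² = ⟪q⃗,b₁⟫² + ⟪q⃗,b₂⟫²`: `k(t,s) = ∫ e^{−tE} 2π e^{−‖q⃗_⊥‖²/2} cos(s⟪q⃗,m⟫) dμ(E,q⃗)` (`t > 0`).
[cite: GlimmJaffeQP1987, §6.2] -/
theorem slice_zero_mk2 {K : E4 → ℝ} {μ : Measure (ℝ × E3)} (hμ : IsLF K μ) {t : ℝ} (ht : 0 < t) (s : ℝ) :
    slice K 0 (mk2 t s) = ∫ p, Real.exp (-(t * p.1)) *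
      (2 * Real.pi * Real.exp (-((((p.2 0 - p.2 1) / Real.sqrt 2) ^ 2 + ((p.2 0 + p.2 1 - 2 * p.2 2) / Real.sqrt 6) ^ 2) / 2)) *
        Real.cos (s * ((p.2 0 + p.2 1 + p.2 2) / Real.sqrt 3))) ∂μ := by
  obtain ⟨-, hint, hrep⟩ := hμ
  haveI : SigmaFinite μ := sigmaFinite_of_integrable_exp μ (hint t ht)
  have hK : ∀ x : E2, K (planeEmb (mk2 t s) + perpEmb x) * weight 0 x =
      ∫ p, Real.exp (-(t * p.1)) * Real.cos (s * ((p.2 0 + p.2 1 + p.2 2) / Real.sqrt 3) +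
        ((p.2 0 - p.2 1) / Real.sqrt 2 * x 0 + (p.2 0 + p.2 1 - 2 * p.2 2) / Real.sqrt 6 * x 1)) *
          Real.exp (-(‖x‖ ^ 2 / 2)) ∂μ := by
    intro x
    rw [planeEmb_mk2_add_perpEmb, hrep t _ ht, weight_zero, ← integral_mul_const]
    refine integral_congr_ae (Eventually.of_forall fun p => ?_)
    simp only [inner_diag_frame]
  unfold slice
  simp_rw [hK]
  have hφ : Integrable (fun x : E2 => Real.exp (-(‖x‖ ^ 2 / 2))) := integrable_exp_neg_half_sq_norm
  have hcont : Continuous fun w : E2 × (ℝ × E3) =>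
      Real.exp (-(t * w.2.1)) * Real.cos (s * ((w.2.2 0 + w.2.2 1 + w.2.2 2) / Real.sqrt 3) +
        ((w.2.2 0 - w.2.2 1) / Real.sqrt 2 * w.1 0 + (w.2.2 0 + w.2.2 1 - 2 * w.2.2 2) / Real.sqrt 6 * w.1 1)) *
          Real.exp (-(‖w.1‖ ^ 2 / 2)) := by
    fun_prop
  have hprod : Integrable (Function.uncurry fun (x : E2) (p : ℝ × E3) =>
      Real.exp (-(t * p.1)) * Real.cos (s * ((p.2 0 + p.2 1 + p.2 2) / Real.sqrt 3) +
        ((p.2 0 - p.2 1) / Real.sqrt 2 * x 0 + (p.2 0 + p.2 1 - 2 * p.2 2) / Real.sqrt 6 * x 1)) *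
          Real.exp (-(‖x‖ ^ 2 / 2))) (volume.prod μ) := by
    refine (hφ.mul_prod (hint t ht)).mono' hcont.aestronglyMeasurable (Eventually.of_forall fun w => ?_)
    rcases w with ⟨x, p⟩
    simp only [Function.uncurry_apply_pair, Real.norm_eq_abs]
    rw [abs_mul, abs_mul, abs_of_pos (Real.exp_pos _), abs_of_pos (Real.exp_pos _)]
    have hcos := Real.abs_cos_le_one (s * ((p.2 0 + p.2 1 + p.2 2) / Real.sqrt 3) +
        ((p.2 0 - p.2 1) / Real.sqrt 2 * x 0 + (p.2 0 + p.2 1 - 2 * p.2 2) / Real.sqrt 6 * x 1))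
    have h1 := Real.exp_pos (-(t * p.1))
    have h2 := Real.exp_pos (-(‖x‖ ^ 2 / 2))
    nlinarith [mul_pos h1 h2]
  rw [integral_integral_swap hprod]
  refine integral_congr_ae (Eventually.of_forall fun p => ?_)
  simp only [mul_assoc]
  rw [integral_const_mul, integral_cos_add_lin_mul_gauss]
  ring

/-! ## 4. A planar Laplace–Fourier measure of the slice: `Φ_* (2π e^{−‖q⃗_⊥‖²/2} · μ)`, `Φ(E, q⃗) = (E, ⟪q⃗, m⟫)` -/

/-- ★ The diagonal Gaussian slice has a planar Laplace–Fourier measure `ν` every null set of which pulls back under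
`Φ(E, q⃗) = (E, (q₁+q₂+q₃)/√3)` to a `μ`-null set (namely `ν = Φ_*(2π e^{−‖q⃗_⊥‖²/2} · μ)`, density `> 0`). -/
theorem exists_isPlanarLF_slice {K : E4 → ℝ} {μ : Measure (ℝ × E3)} (hμ : IsLF K μ) :
    ∃ ν : Measure (ℝ × ℝ), IsPlanarLF (slice K 0) ν ∧
      ∀ S : Set (ℝ × ℝ), MeasurableSet S → ν S = 0 →
        μ ((fun p : ℝ × E3 => (p.1, (p.2 0 + p.2 1 + p.2 2) / Real.sqrt 3)) ⁻¹' S) = 0 := by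
  -- the objects, generalized
  obtain ⟨G, hG⟩ : ∃ G : E3 → ℝ, G = fun q =>
      2 * Real.pi * Real.exp (-((((q 0 - q 1) / Real.sqrt 2) ^ 2 + ((q 0 + q 1 - 2 * q 2) / Real.sqrt 6) ^ 2) / 2)) :=
    ⟨_, rfl⟩
  obtain ⟨Φ, hΦ⟩ : ∃ Φ : ℝ × E3 → ℝ × ℝ, Φ = fun p => (p.1, (p.2 0 + p.2 1 + p.2 2) / Real.sqrt 3) := ⟨_, rfl⟩
  have hGpos : ∀ q, 0 < G q := fun q => by rw [hG]; positivity
  have hGle : ∀ q, G q ≤ 2 * Real.pi := fun q => by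
    rw [hG]
    have h : Real.exp (-((((q 0 - q 1) / Real.sqrt 2) ^ 2 + ((q 0 + q 1 - 2 * q 2) / Real.sqrt 6) ^ 2) / 2)) ≤ 1 :=
      Real.exp_le_one_iff.mpr
        (by nlinarith [sq_nonneg ((q 0 - q 1) / Real.sqrt 2), sq_nonneg ((q 0 + q 1 - 2 * q 2) / Real.sqrt 6)])
    nlinarith [Real.pi_pos]
  have hGcont : Continuous G := by rw [hG]; fun_prop
  have hΦcont : Continuous Φ := by rw [hΦ]; fun_prop
  have hΦm : Measurable Φ := hΦcont.measurable
  have hΦ1 : ∀ p, (Φ p).1 = p.1 := fun p => by rw [hΦ]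
  have hΦ2 : ∀ p, (Φ p).2 = (p.2 0 + p.2 1 + p.2 2) / Real.sqrt 3 := fun p => by rw [hΦ]
  -- the density
  obtain ⟨dens, hdens⟩ : ∃ dens : ℝ × E3 → ℝ≥0, dens = fun p => (G p.2).toNNReal := ⟨_, rfl⟩
  have hdm : Measurable dens := by rw [hdens]; exact ((hGcont.comp continuous_snd).measurable).real_toNNReal
  have hcoe : ∀ p, (dens p : ℝ) = G p.2 := fun p => by rw [hdens]; exact Real.coe_toNNReal _ (hGpos _).le
  have hne : ∀ p, (dens p : ℝ≥0∞) ≠ 0 := fun p => by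
    rw [ENNReal.coe_ne_zero, hdens]
    exact fun h => absurd (Real.toNNReal_eq_zero.mp h) (not_le.mpr (hGpos p.2))
  refine ⟨(μ.withDensity fun p => (dens p : ℝ≥0∞)).map Φ, ⟨?_, fun t ht => ⟨?_, fun x => ?_⟩⟩, fun S hS hS0 => ?_⟩
  · -- no mass at negative energy
    rw [Measure.map_apply hΦm (measurableSet_Iio.prod MeasurableSet.univ),
      withDensity_apply _ (hΦm (measurableSet_Iio.prod MeasurableSet.univ))]
    apply setLIntegral_measure_zero
    have : Φ ⁻¹' (Iio (0 : ℝ) ×ˢ (univ : Set ℝ)) = Iio (0 : ℝ) ×ˢ (univ : Set E3) := by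
      ext p; simp [hΦ1]
    rw [this]
    exact hμ.1
  · -- integrability of `e^{−tE}`
    rw [integrable_map_measure (by fun_prop) hΦm.aemeasurable, integrable_withDensity_iff_integrable_smul hdm]
    have : (fun p : ℝ × E3 => dens p • ((fun z : ℝ × ℝ => Real.exp (-(t * z.1))) ∘ Φ) p) =
        fun p => G p.2 * Real.exp (-(t * p.1)) := by
      funext p; simp only [Function.comp, hΦ1, NNReal.smul_def, hcoe, smul_eq_mul]
    rw [this]
    refine (hμ.2.1 t ht).bdd_mul (c := 2 * Real.pi) (hGcont.comp continuous_snd).aestronglyMeasurable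
      (Eventually.of_forall fun p => ?_)
    rw [Real.norm_eq_abs, abs_of_pos (hGpos _)]
    exact hGle _
  · -- the Laplace–Fourier formula
    rw [slice_zero_mk2 hμ ht x, integral_map hΦm.aemeasurable (by fun_prop),
      integral_withDensity_eq_integral_smul hdm]
    refine integral_congr_ae (Eventually.of_forall fun p => ?_)
    simp only [NNReal.smul_def, hcoe, smul_eq_mul, hΦ1, hΦ2, hG]
    rw [mul_comm (p.1) t, mul_comm ((p.2 0 + p.2 1 + p.2 2) / Real.sqrt 3) x]
    ring
  · -- null sets pull back
    rw [Measure.map_apply hΦm hS, withDensity_apply_eq_zero' hdm.coe_nnreal_ennreal.aemeasurable] at hS0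
    have huniv : {p : ℝ × E3 | (dens p : ℝ≥0∞) ≠ 0} = univ := eq_univ_of_forall fun p => hne p
    rw [huniv, univ_inter, hΦ] at hS0
    exact hS0

/-! ## 5. Diagonal cone support -/

/-- ★★ **DIAGONAL CONE SUPPORT.**  For every kernel `K` of the C3 class and every Laplace–Fourier measure `μ` of `K`:
`μ {E < |q₁+q₂+q₃|/√3} = 0` — the spectral measure is carried by the cone `{E ≥ |⟪q⃗, m⟫|}`, `m = (1,1,1)/√3`
(planar cone theorem (C) ✓`planarConeSupport_holds` applied to the diagonal Gaussian slice ✓`stub_sliceInClass`, whose planar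
Laplace–Fourier measure `Φ_*(2π e^{−‖q⃗_⊥‖²/2} · μ)` has an everywhere positive density). -/
theorem measure_lt_abs_diag_eq_zero (K : E4 → ℝ) (μ : Measure (ℝ × E3)) (hK : InClass K) (hμ : IsLF K μ) :
    μ {p | p.1 < |p.2 0 + p.2 1 + p.2 2| / Real.sqrt 3} = 0 := by
  have hcl : InPlanarClass (slice K 0) := stub_sliceInClass K hK 0
  obtain ⟨ν, hν, hpull⟩ := exists_isPlanarLF_slice hμ
  have hap : HasAperture ν 1 := planarConeSupport_holds _ _ hcl hν
  unfold HasAperture at hap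
  have hS : MeasurableSet {z : ℝ × ℝ | z.1 < 1 * |z.2|} :=
    (isOpen_lt continuous_fst (by fun_prop)).measurableSet
  have h0 := hpull _ hS hap
  convert h0 using 2
  ext p
  simp only [Set.mem_setOf_eq, Set.mem_preimage, one_mul, abs_div,
    abs_of_pos (Real.sqrt_pos.mpr (by norm_num : (0:ℝ) < 3))]

end Summit.QuantumFields.YangMills.Theorems.F4SubCurvatureDoorDiagonalConeSupport

end
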